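import Literature.Barriers.CriticalPhenomena.SAPWords
import Mathlib.Data.Prod.Lex
import HarnessLib

/-!
# Rooting self-avoiding polygons: canonical words (haruspicy, layer 2)

Companion of `SAPAnisotropicNotDFinite` / `SAPWords` (towards `Rechnitzer2006_thm1`). A SAP
word (`Haruspicy.IsSAP`: a rooted, oriented self-avoiding polygon of `ℤ²`) can be re-rooted
(`List.rotate`) and reversed (`Haruspicy.rev`); the `2N` words so obtained from one polygon with
`N` bonds are pairwise distinct ("each `N`-step self-avoiding polygon has precisely `2N`
corresponding self-avoiding walks", Madras–Slade (3.2.1)). We single out one of them, the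
**canonical word** (`Haruspicy.IsCanon`): rooted at the lexicographically least vertex (least
`y`, then least `x`; `Haruspicy.key`) and oriented so that the first letter is `E`. Main results:

* `card_sapWords_eq` : `#sapWords N h = 2 N · #canonWords N h`;
* `polygonCount_eq_card_canonWords` : `polygonCount m n = #canonWords (2(m+n)) (2m)` — the
  polygons counted up to translation by `p_{m,n}` are exactly the canonical words.

[folklore] throughout (elementary combinatorics of words).

## References

* N. Madras, G. Slade, *The Self-Avoiding Walk* (1993), Definition 3.2.2 and eq. (3.2.1).
  [MadrasSlade1993]
* A. Rechnitzer, *Haruspicy 2*, J. Combin. Theory Ser. A 113 (2006), §1. [Rechnitzer2006Haruspicy2]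
-/

noncomputable section

open Finset Literature.Probability.LatticeModels Literature.Probability.Percolation
open scoped BigOperators

namespace Literature.Barriers.CriticalPhenomena

namespace Haruspicy

open Edwards2D

/-! ### Vertices of suffixes; periodicity of closed words -/

/-- Vertices of a suffix: `vtx (w.drop r) i = vtx w (r+i) - vtx w r`. [folklore] -/
theorem vtx_drop (w : List (Fin 4)) (r i : ℕ) : vtx (w.drop r) i = vtx w (r + i) - vtx w r := by
  rw [eq_sub_iff_add_eq', vtx, vtx, vtx, ← List.sum_append, ← List.map_append, ← List.take_add]

/-- The steps of a suffix sum to the total minus the prefix vertex. [folklore] -/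
theorem sum_map_drop (w : List (Fin 4)) (r : ℕ) :
    ((w.drop r).map stepVec).sum = (w.map stepVec).sum - vtx w r := by
  rw [eq_sub_iff_add_eq', vtx, List.map_take, List.map_drop, List.sum_take_add_sum_drop]

/-- For a closed word, `vtx w (i % N) = vtx w i` for `i ≤ N = |w|`. [folklore] -/
theorem vtx_mod (w : List (Fin 4)) (hc : (w.map stepVec).sum = 0) {i : ℕ} (hi : i ≤ w.length) :
    vtx w (i % w.length) = vtx w i := by
  rcases hi.lt_or_eq with h | h
  · rw [Nat.mod_eq_of_lt h]
  · rw [h, Nat.mod_self, vtx_zero, vtx_length, hc]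

/-- `a % N = a - N` for `N ≤ a < 2N`. [folklore] -/
theorem mod_eq_sub_of_lt {a N : ℕ} (h1 : N ≤ a) (h2 : a < 2 * N) : a % N = a - N := by
  rw [Nat.mod_eq_sub_mod h1, Nat.mod_eq_of_lt (by omega)]

variable {w : List (Fin 4)}

/-- A SAP word has positive length. [folklore] -/
theorem IsSAP.length_pos (h : IsSAP w) : 0 < w.length := by
  have := h.1
  omega

/-- In a SAP word two vertices with indices `≤ N` coincide only if the indices agree mod `N`.
[folklore] -/
theorem IsSAP.mod_eq_mod (h : IsSAP w) {i j : ℕ} (hi : i ≤ w.length) (hj : j ≤ w.length)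
    (he : vtx w i = vtx w j) : i % w.length = j % w.length := by
  rw [← vtx_mod w h.2.1 hi, ← vtx_mod w h.2.1 hj] at he
  exact h.2.2 (Nat.mod_lt _ h.length_pos) (Nat.mod_lt _ h.length_pos) he

/-! ### Re-rooting: rotation -/

/-- Vertices of a rotated closed word: `vtx (w.rotate r) i = vtx w ((r+i) % N) - vtx w r`.
[folklore] -/
theorem vtx_rotate (hc : (w.map stepVec).sum = 0) {r i : ℕ} (hr : r < w.length)
    (hi : i ≤ w.length) : vtx (w.rotate r) i = vtx w ((r + i) % w.length) - vtx w r := by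
  rw [List.rotate_eq_drop_append_take hr.le]
  rcases le_or_gt (r + i) w.length with h | h
  · rw [vtx_append_left _ _ (by simp; omega), vtx_drop, vtx_mod w hc h]
  · obtain ⟨j, rfl⟩ : ∃ j, i = (w.drop r).length + j := ⟨i - (w.length - r), by simp; omega⟩
    simp only [List.length_drop] at h hi
    rw [vtx_append_add, sum_map_drop, hc, zero_sub, vtx_take _ (show j ≤ r by omega),
      List.length_drop, show r + (w.length - r + j) = w.length + j by omega, Nat.add_mod_left,
      Nat.mod_eq_of_lt (show j < w.length by omega)]
    abel

/-- Rotation preserves the step sum. [folklore] -/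
theorem sum_map_rotate (w : List (Fin 4)) (r : ℕ) :
    ((w.rotate r).map stepVec).sum = (w.map stepVec).sum :=
  ((List.rotate_perm w r).map stepVec).sum_eq

/-- Rotation preserves the number of horizontal letters. [folklore] -/
theorem hcount_rotate (w : List (Fin 4)) (r : ℕ) : hcount (w.rotate r) = hcount w :=
  (List.rotate_perm w r).countP_eq _

/-- Re-rooting a SAP word gives a SAP word. [folklore] -/
theorem IsSAP.rotate (h : IsSAP w) {r : ℕ} (hr : r < w.length) : IsSAP (w.rotate r) := by
  refine ⟨by rw [List.length_rotate]; exact h.1, by rw [sum_map_rotate]; exact h.2.1, ?_⟩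
  intro i hi j hj hij
  simp only [Set.mem_Iio, List.length_rotate] at hi hj
  rw [vtx_rotate h.2.1 hr hi.le, vtx_rotate h.2.1 hr hj.le, sub_left_inj] at hij
  have key := h.2.2 (Nat.mod_lt _ h.length_pos) (Nat.mod_lt _ h.length_pos) hij
  rcases lt_or_ge (r + i) w.length with h1 | h1 <;> rcases lt_or_ge (r + j) w.length with h2 | h2
  · rw [Nat.mod_eq_of_lt h1, Nat.mod_eq_of_lt h2] at key; omega
  · rw [Nat.mod_eq_of_lt h1, mod_eq_sub_of_lt h2 (by omega)] at key; omega
  · rw [mod_eq_sub_of_lt h1 (by omega), Nat.mod_eq_of_lt h2] at key; omega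
  · rw [mod_eq_sub_of_lt h1 (by omega), mod_eq_sub_of_lt h2 (by omega)] at key; omega

/-- Rotating by `r < N` and then by `(N - r) % N` is the identity. [folklore] -/
theorem rotate_rotate_sub_mod {N r : ℕ} (hl : w.length = N) (hr : r < N) :
    (w.rotate r).rotate ((N - r) % N) = w := by
  rw [List.rotate_rotate]
  rcases Nat.eq_zero_or_pos r with rfl | hpos
  · rw [Nat.sub_zero, Nat.mod_self, List.rotate_zero]
  · rw [Nat.mod_eq_of_lt (by omega), Nat.add_sub_cancel' hr.le, ← hl, List.rotate_length]

/-! ### Reversal -/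

/-- The opposite step: `E ↔ W`, `N ↔ S`. [folklore] -/
def inv : Fin 4 → Fin 4 := ![1, 0, 3, 2]

/-- `inv` is an involution. [folklore] -/
@[simp] theorem inv_inv (a : Fin 4) : inv (inv a) = a := by
  fin_cases a <;> rfl

/-- The opposite step is the negative step. [folklore] -/
@[simp] theorem stepVec_inv (a : Fin 4) : stepVec (inv a) = -stepVec a := by
  fin_cases a <;> simp [inv]

/-- `inv` preserves horizontality. [folklore] -/
theorem inv_lt_two_iff (a : Fin 4) : (inv a).val < 2 ↔ a.val < 2 := by
  fin_cases a <;> simp [inv]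

/-- The reversed word: read backwards with opposite steps (the same polygon, same root, opposite
orientation). [folklore] -/
def rev (w : List (Fin 4)) : List (Fin 4) := (w.map inv).reverse

/-- Reversal preserves the length. [folklore] -/
@[simp] theorem length_rev (w : List (Fin 4)) : (rev w).length = w.length := by
  simp [rev]

/-- Reversal is an involution. [folklore] -/
@[simp] theorem rev_rev (w : List (Fin 4)) : rev (rev w) = w := by
  simp [rev, List.map_reverse, Function.comp_def]

/-- Reversal preserves the number of horizontal letters. [folklore] -/
theorem hcount_rev (w : List (Fin 4)) : hcount (rev w) = hcount w := by
  simp only [hcount, rev, List.countP_reverse, List.countP_map]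
  congr 1
  funext a
  fin_cases a <;> simp [inv]

/-- The opposite steps sum to the negative. [folklore] -/
theorem sum_map_stepVec_inv (l : List (Fin 4)) :
    (l.map (stepVec ∘ inv)).sum = -(l.map stepVec).sum := by
  rw [List.sum_neg, List.map_map]
  congr 2
  funext a
  simp

/-- Reversal negates the step sum. [folklore] -/
theorem sum_map_rev (w : List (Fin 4)) : ((rev w).map stepVec).sum = -(w.map stepVec).sum := by
  rw [rev, List.map_reverse, List.sum_reverse, List.map_map, sum_map_stepVec_inv]

/-- Vertices of the reversed word: `vtx (rev w) i = vtx w (N - i) - vtx w N`. [folklore] -/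
theorem vtx_rev (w : List (Fin 4)) (i : ℕ) :
    vtx (rev w) i = vtx w (w.length - i) - (w.map stepVec).sum := by
  rw [vtx, rev, List.take_reverse, List.map_reverse, List.sum_reverse, List.length_map,
    ← List.map_drop, List.map_map, sum_map_stepVec_inv, sum_map_drop]
  abel

/-- The first letter of the reversed word is the opposite of the last letter. [folklore] -/
theorem head?_rev (w : List (Fin 4)) : (rev w).head? = w.getLast?.map inv := by
  simp [rev, List.head?_reverse, List.getLast?_map]

/-- Reversing a SAP word gives a SAP word. [folklore] -/
theorem isSAP_rev (h : IsSAP w) : IsSAP (rev w) := by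
  refine ⟨by rw [length_rev]; exact h.1, by rw [sum_map_rev, h.2.1, neg_zero], ?_⟩
  intro i hi j hj hij
  simp only [Set.mem_Iio, length_rev] at hi hj
  rw [vtx_rev w i, vtx_rev w j, sub_left_inj] at hij
  have key := h.mod_eq_mod (Nat.sub_le _ _) (Nat.sub_le _ _) hij
  rcases Nat.eq_zero_or_pos i with rfl | h1 <;> rcases Nat.eq_zero_or_pos j with rfl | h2
  · rfl
  · rw [Nat.sub_zero, Nat.mod_self, Nat.mod_eq_of_lt (by omega)] at key; omega
  · rw [Nat.sub_zero, Nat.mod_self, Nat.mod_eq_of_lt (by omega)] at key; omega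
  · rw [Nat.mod_eq_of_lt (by omega), Nat.mod_eq_of_lt (by omega)] at key; omega

/-! ### The lexicographic key and rooting at the least vertex -/

/-- The key of a site: `(y, x)` in lexicographic order (least `y` first, then least `x`).
[folklore] -/
def key (v : Site 2) : Lex (ℤ × ℤ) := toLex (v 1, v 0)

/-- Comparison of keys. [folklore] -/
theorem key_le_key {a b : Site 2} : key a ≤ key b ↔ a 1 < b 1 ∨ (a 1 = b 1 ∧ a 0 ≤ b 0) := by
  rw [key, key, Prod.Lex.le_iff]
  simp

/-- The key determines the site. [folklore] -/
theorem key_injective : Function.Injective key := by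
  intro a b h
  have h' := congrArg ofLex h
  simp only [key, ofLex_toLex, Prod.mk.injEq] at h'
  funext i
  fin_cases i
  · exact h'.2
  · exact h'.1

/-- The lexicographic order is translation invariant. [folklore] -/
theorem key_sub_le_key_sub {a b t : Site 2} : key (a - t) ≤ key (b - t) ↔ key a ≤ key b := by
  simp only [key_le_key, Pi.sub_apply]
  omega

/-- Which unit steps have non-negative key: `E` and `N`. [folklore] -/
theorem key_zero_le_key_stepVec_iff (a : Fin 4) : key 0 ≤ key (stepVec a) ↔ (a = 0 ∨ a = 2) := by
  fin_cases a <;> simp [key_le_key]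

/-- Which negated unit steps have non-negative key: those of `W` and `S`. [folklore] -/
theorem key_zero_le_key_neg_stepVec_iff (a : Fin 4) :
    key 0 ≤ key (-stepVec a) ↔ (a = 1 ∨ a = 3) := by
  fin_cases a <;> simp [key_le_key]

/-- A word is rooted at its least vertex. [folklore] -/
def IsRooted (w : List (Fin 4)) : Prop :=
  ∀ i < w.length, key 0 ≤ key (vtx w i)

/-- **Canonical words**: SAP words rooted at the least vertex whose first letter is `E` — one
representative per polygon-up-to-translation. [folklore] -/
def IsCanon (w : List (Fin 4)) : Prop :=
  IsSAP w ∧ IsRooted w ∧ w.head? = some 0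

open Classical in
/-- The canonical words of length `N` with `h` horizontal letters. [folklore] -/
def canonWords (N h : ℕ) : Finset (List (Fin 4)) :=
  (wordsOfLength N).filter fun w => IsCanon w ∧ hcount w = h

/-- Membership in `canonWords`. [folklore] -/
theorem mem_canonWords {N h : ℕ} {w : List (Fin 4)} :
    w ∈ canonWords N h ↔ w.length = N ∧ IsCanon w ∧ hcount w = h := by
  classical
  simp [canonWords, mem_wordsOfLength]

/-- Some index below `N` minimises the key of the vertex. [folklore] -/
theorem exists_min_key (hN : 0 < w.length) :
    ∃ s, s < w.length ∧ ∀ j < w.length, key (vtx w s) ≤ key (vtx w j) := by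
  obtain ⟨s, hs, hmin⟩ := Finset.exists_min_image (Finset.range w.length)
    (fun i => key (vtx w i)) ⟨0, by simpa using hN⟩
  exact ⟨s, by simpa using hs, fun j hj => hmin j (by simpa using hj)⟩

open Classical in
/-- The index (below `N`) of the least vertex of a word (`0` for the empty word). [folklore] -/
def minIdx (w : List (Fin 4)) : ℕ :=
  if h : ∃ s, s < w.length ∧ ∀ j < w.length, key (vtx w s) ≤ key (vtx w j) then Nat.find h
  else 0

/-- `minIdx` is an index below `N` minimising the key. [folklore] -/
theorem minIdx_spec (hN : 0 < w.length) :
    minIdx w < w.length ∧ ∀ j < w.length, key (vtx w (minIdx w)) ≤ key (vtx w j) := by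
  have h := exists_min_key hN
  unfold minIdx
  rw [dif_pos h]
  exact Nat.find_spec h

/-- In a SAP word the minimising index is unique. [folklore] -/
theorem IsSAP.eq_minIdx (h : IsSAP w) {t : ℕ} (ht : t < w.length)
    (hmin : ∀ j < w.length, key (vtx w t) ≤ key (vtx w j)) : t = minIdx w := by
  obtain ⟨hs, hsmin⟩ := minIdx_spec h.length_pos
  have hk : key (vtx w t) = key (vtx w (minIdx w)) := le_antisymm (hmin _ hs) (hsmin _ ht)
  exact h.2.2 ht hs (key_injective hk)

/-- Re-rooting a SAP word at its least vertex makes it rooted. [folklore] -/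
theorem IsSAP.isRooted_rotate_minIdx (h : IsSAP w) : IsRooted (w.rotate (minIdx w)) := by
  obtain ⟨hs, hmin⟩ := minIdx_spec h.length_pos
  intro i hi
  rw [List.length_rotate] at hi
  rw [vtx_rotate h.2.1 hs hi.le]
  have := (key_sub_le_key_sub (t := vtx w (minIdx w)) (a := vtx w (minIdx w))
    (b := vtx w ((minIdx w + i) % w.length))).2 (hmin _ (Nat.mod_lt _ h.length_pos))
  rwa [sub_self] at this

/-- For a rooted SAP word `y` and `r < N`, the least vertex of `y.rotate r` sits at index
`(N - r) % N`. [folklore] -/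
theorem minIdx_rotate (hy : IsSAP w) (hr : IsRooted w) {r : ℕ} (hrN : r < w.length) :
    minIdx (w.rotate r) = (w.length - r) % w.length := by
  symm
  have hN := hy.length_pos
  refine (hy.rotate hrN).eq_minIdx (by rw [List.length_rotate]; exact Nat.mod_lt _ hN) ?_
  intro j hj
  rw [List.length_rotate] at hj
  have h0 : (r + (w.length - r) % w.length) % w.length = 0 := by
    rcases Nat.eq_zero_or_pos r with rfl | hpos
    · simp
    · rw [Nat.mod_eq_of_lt (show w.length - r < w.length by omega), Nat.add_sub_cancel' hrN.le,
        Nat.mod_self]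
  rw [vtx_rotate hy.2.1 hrN (Nat.mod_lt _ hN).le, vtx_rotate hy.2.1 hrN hj.le, h0, vtx_zero,
    key_sub_le_key_sub]
  exact hr _ (Nat.mod_lt _ hN)

/-- Reversal preserves rootedness of SAP words. [folklore] -/
theorem isRooted_rev (h : IsSAP w) (hr : IsRooted w) : IsRooted (rev w) := by
  intro i hi
  rw [length_rev] at hi
  rw [vtx_rev w i, h.2.1, sub_zero]
  rcases Nat.eq_zero_or_pos i with rfl | hpos
  · rw [Nat.sub_zero, vtx_length, h.2.1]
  · exact hr _ (by omega)

/-- **First and last letter of a rooted SAP word**: at its least vertex a polygon leaves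
eastwards and returns from the north, or leaves northwards and returns from the east:
`(first, last) = (E, S)` or `(N, W)`. [folklore] -/
theorem IsSAP.head_last (h : IsSAP w) (hr : IsRooted w) :
    (w.head? = some 0 ∧ w.getLast? = some 3) ∨ (w.head? = some 2 ∧ w.getLast? = some 1) := by
  obtain ⟨hlen, hc, hinj⟩ := h
  have h0 : 0 < w.length := by omega
  have hN1 : w.length - 1 < w.length := by omega
  have h1 : key 0 ≤ key (vtx w 1) := hr 1 (by omega)
  rw [vtx_succ w h0, vtx_zero, zero_add, key_zero_le_key_stepVec_iff] at h1
  have hlast : vtx w (w.length - 1) + stepVec w[w.length - 1] = 0 := by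
    rw [← vtx_succ w hN1, Nat.sub_add_cancel (by omega), vtx_length, hc]
  have h2 : key 0 ≤ key (vtx w (w.length - 1)) := hr _ hN1
  rw [eq_neg_of_add_eq_zero_left hlast, key_zero_le_key_neg_stepVec_iff] at h2
  have hne : vtx w 1 ≠ vtx w (w.length - 1) := fun he => by
    have := hinj (show 1 ∈ Set.Iio w.length by simp; omega)
      (show w.length - 1 ∈ Set.Iio w.length by simpa using hN1) he
    omega
  rw [vtx_succ w h0, vtx_zero, zero_add, eq_neg_of_add_eq_zero_left hlast] at hne
  rw [List.head?_eq_getElem?, List.getLast?_eq_getElem?, List.getElem?_eq_getElem h0,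
    List.getElem?_eq_getElem hN1]
  simp only [Option.some.injEq]
  rcases h1 with h1 | h1 <;> rcases h2 with h2 | h2 <;> simp only [h1, h2] at hne ⊢ <;> simp at hne ⊢

/-- A canonical word ends with the letter `S`. [folklore] -/
theorem IsCanon.getLast? (h : IsCanon w) : w.getLast? = some 3 := by
  rcases h.1.head_last h.2.1 with h1 | h1
  · exact h1.2
  · have := h.2.2
    rw [h1.1] at this
    exact absurd (Option.some.inj this) (by decide)

/-- The canonical representative attached to a SAP word: re-root at the least vertex, then
reverse if the first letter is not `E`. [folklore] -/
def canonOf (u : List (Fin 4)) : List (Fin 4) :=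
  if (u.rotate (minIdx u)).head? = some 0 then u.rotate (minIdx u) else rev (u.rotate (minIdx u))

/-- The orientation flag of a SAP word: whether `canonOf` had to reverse it. [folklore] -/
def flagOf (u : List (Fin 4)) : Bool :=
  !decide ((u.rotate (minIdx u)).head? = some 0)

/-- Undoing the flag: `rev^flag (canonOf u)` is `u` re-rooted at its least vertex. [folklore] -/
theorem cond_flagOf_canonOf (u : List (Fin 4)) :
    (bif flagOf u then rev (canonOf u) else canonOf u) = u.rotate (minIdx u) := by
  unfold flagOf canonOf
  by_cases h : (u.rotate (minIdx u)).head? = some 0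
  · simp [h]
  · simp [h]

/-- `canonOf` of a SAP word is canonical, with the same length and horizontal count. [folklore] -/
theorem IsSAP.isCanon_canonOf (h : IsSAP w) :
    IsCanon (canonOf w) ∧ (canonOf w).length = w.length ∧ hcount (canonOf w) = hcount w := by
  obtain ⟨hs, -⟩ := minIdx_spec h.length_pos
  have hx : IsSAP (w.rotate (minIdx w)) := h.rotate hs
  have hxr : IsRooted (w.rotate (minIdx w)) := h.isRooted_rotate_minIdx
  unfold canonOf
  by_cases hh : (w.rotate (minIdx w)).head? = some 0
  · rw [if_pos hh]
    exact ⟨⟨hx, hxr, hh⟩, List.length_rotate _ _, hcount_rotate _ _⟩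
  · rw [if_neg hh]
    refine ⟨⟨isSAP_rev hx, isRooted_rev hx hxr, ?_⟩, by rw [length_rev, List.length_rotate],
      by rw [hcount_rev, hcount_rotate]⟩
    rcases hx.head_last hxr with h1 | h1
    · exact absurd h1.1 hh
    · rw [head?_rev, h1.2]
      rfl

/-- Re-rooting bookkeeping for a rooted SAP word `y` of length `N` and a shift `r < N`: the least
vertex of `y.rotate r` is at `(N - r) % N`, rotating back gives `y`, and the shift is recovered.
[folklore] -/
theorem rotate_aux {N r : ℕ} (hy : IsSAP w) (hyr : IsRooted w) (hl : w.length = N) (hr : r < N) :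
    minIdx (w.rotate r) = (N - r) % N ∧ (w.rotate r).rotate ((N - r) % N) = w ∧
      (N - (N - r) % N) % N = r := by
  refine ⟨by rw [← hl]; exact minIdx_rotate hy hyr (hl ▸ hr), rotate_rotate_sub_mod hl hr, ?_⟩
  rcases Nat.eq_zero_or_pos r with rfl | hpos
  · simp
  · rw [Nat.mod_eq_of_lt (show N - r < N by omega), Nat.sub_sub_self hr.le, Nat.mod_eq_of_lt hr]

/-- **Each polygon is rooted and oriented in exactly `2N` ways**: the SAP words of length `N`
with `h` horizontal letters are `2N` times as many as the canonical ones ("each `N`-step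
self-avoiding polygon has precisely `2N` corresponding self-avoiding walks").
[cite: MadrasSlade1993, eq. (3.2.1)] -/
theorem card_sapWords_eq (N hc : ℕ) : (sapWords N hc).card = 2 * N * (canonWords N hc).card := by
  rcases Nat.eq_zero_or_pos N with rfl | hN
  · rw [Nat.mul_zero, Nat.zero_mul, Finset.card_eq_zero, Finset.eq_empty_iff_forall_notMem]
    intro w hw
    rw [mem_sapWords] at hw
    have := hw.2.1.1
    omega
  have key : (canonWords N hc ×ˢ (Finset.univ : Finset (Fin N × Bool))).card =
      (sapWords N hc).card := by
    apply Finset.card_nbij' (fun p => (bif p.2.2 then rev p.1 else p.1).rotate p.2.1.val)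
      (fun u => (canonOf u, (⟨(N - minIdx u) % N, Nat.mod_lt _ hN⟩, flagOf u)))
    · -- forward map lands in SAP words
      rintro ⟨c, r, b⟩ hp
      simp only [Finset.mem_coe, Finset.mem_product, mem_canonWords] at hp
      obtain ⟨⟨hlen, hcan, hhc⟩, -⟩ := hp
      have hy : IsSAP (bif b then rev c else c) ∧ (bif b then rev c else c).length = N ∧
          hcount (bif b then rev c else c) = hc := by
        cases b
        · exact ⟨hcan.1, hlen, hhc⟩
        · exact ⟨isSAP_rev hcan.1, by rw [cond_true, length_rev, hlen],
            by rw [cond_true, hcount_rev, hhc]⟩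
      rw [Finset.mem_coe, mem_sapWords]
      exact ⟨by rw [List.length_rotate, hy.2.1], hy.1.rotate (by rw [hy.2.1]; exact r.isLt),
        by rw [hcount_rotate, hy.2.2]⟩
    · -- backward map lands in the product
      intro u hu
      rw [Finset.mem_coe, mem_sapWords] at hu
      obtain ⟨hlen, hsap, hhc⟩ := hu
      rw [Finset.mem_coe, Finset.mem_product, mem_canonWords]
      obtain ⟨h1, h2, h3⟩ := hsap.isCanon_canonOf
      exact ⟨⟨by rw [h2, hlen], h1, by rw [h3, hhc]⟩, Finset.mem_univ _⟩
    · -- left inverse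
      rintro ⟨c, ⟨r, hr⟩, b⟩ hp
      simp only [Finset.mem_coe, Finset.mem_product, mem_canonWords] at hp
      obtain ⟨⟨hlen, hcan, -⟩, -⟩ := hp
      have hheadrev : (rev c).head? ≠ some 0 := by
        rw [head?_rev, hcan.getLast?]
        decide
      dsimp only
      cases b
      · obtain ⟨hs, hrot, hfin⟩ := rotate_aux hcan.1 hcan.2.1 hlen hr
        simp only [cond_false]
        refine Prod.ext ?_ (Prod.ext (Fin.ext ?_) ?_)
        · show canonOf (c.rotate r) = c
          rw [canonOf, hs, hrot, if_pos hcan.2.2]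
        · show (N - minIdx (c.rotate r)) % N = r
          rw [hs, hfin]
        · show flagOf (c.rotate r) = false
          rw [flagOf, hs, hrot, hcan.2.2]
          decide
      · obtain ⟨hs, hrot, hfin⟩ := rotate_aux (isSAP_rev hcan.1) (isRooted_rev hcan.1 hcan.2.1)
          (by rw [length_rev, hlen]) hr
        simp only [cond_true]
        refine Prod.ext ?_ (Prod.ext (Fin.ext ?_) ?_)
        · show canonOf ((rev c).rotate r) = c
          rw [canonOf, hs, hrot, if_neg hheadrev, rev_rev]
        · show (N - minIdx ((rev c).rotate r)) % N = r
          rw [hs, hfin]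
        · show flagOf ((rev c).rotate r) = true
          rw [flagOf, hs, hrot]
          simpa using hheadrev
    · -- right inverse
      intro u hu
      rw [Finset.mem_coe, mem_sapWords] at hu
      obtain ⟨hlen, hsap, -⟩ := hu
      simp only [cond_flagOf_canonOf]
      have hs : minIdx u < N := hlen ▸ (minIdx_spec hsap.length_pos).1
      exact rotate_rotate_sub_mod hlen hs
  rw [← key, Finset.card_product, Finset.card_univ, Fintype.card_prod, Fintype.card_fin,
    Fintype.card_bool]
  ring

/-- **Polygons up to translation are canonical words**: `p_{m,n} = polygonCount m n` is the
number of canonical words of length `2(m+n)` with `2m` horizontal letters.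
[cite: MadrasSlade1993, Definition 3.2.2 and eq. (3.2.1)] -/
theorem polygonCount_eq_card_canonWords (m n : ℕ) :
    polygonCount m n = (canonWords (2 * (m + n)) (2 * m)).card := by
  rw [polygonCount, rootedPolygonCount_eq_card_sapWords, card_sapWords_eq]
  rcases Nat.eq_zero_or_pos (m + n) with h0 | hpos
  · have hm : m = 0 := by omega
    have hn : n = 0 := by omega
    subst hm hn
    simp only [Nat.add_zero, Nat.mul_zero, Nat.zero_mul, Nat.zero_div]
    symm
    rw [Finset.card_eq_zero, Finset.eq_empty_iff_forall_notMem]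
    intro w hw
    rw [mem_canonWords] at hw
    have := hw.2.1.1.1
    omega
  · rw [Nat.mul_div_cancel_left _ (by omega)]

end Haruspicy

end Literature.Barriers.CriticalPhenomena
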